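import Summits.BirchSwinnertonDyer.Rank1Residual.X11b.Three.RouteR1Descent
import Summits.BirchSwinnertonDyer.Rank1Residual.X11b.Three.RouteR1Tamagawa
import Summits.BirchSwinnertonDyer.Rank1Residual.X11b.Three.RouteR1GrossZagier
import Summits.BirchSwinnertonDyer.Rank1Residual.X11b.BDPRouteOpenInputOdd
import Summits.BirchSwinnertonDyer.Rank1Residual.X11b.LocalTorsionMultiplicative
import HarnessLib

/-!
# X11b at `p = 3`, route R1's DESCENT half — END FORMS: the two stubs discharged; the `p = 3` two-routes statement (cell `b2b-bsdres`, team `x11b3`, seat p6, sub-target R1@3-DESCENT)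

HONEST FRAMING (cell `b2b-bsdres`, run/shared/lean/b2b/bsd-rank1-residual/, verbatim in every
file): the goal of the cell is to DELETE the COMBINATION-SHAPED residual classes of the
Birch–Swinnerton-Dyer formula for ALL analytic-rank `≤ 1` elliptic curves over `ℚ` — "full BSD
formula for every rank `≤ 1` curve in class `C`" assembled STRICTLY from published theorems — so
that the rank-`≤ 1` remainder becomes exactly the CONSTRUCTION-SHAPED classes, which are TYPED
(missing-input `Prop`s), NOT attempted. This is not "finishing BSD". Team `x11b3` (N8/O2: X11b at
`p = 3` — `3 ∥ N`, `r = 1`, `E[3]` irreducible; STEP L at `3`); a RESEARCH ROUTE; no claim beyond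
the stated class and sub-populations; X11 ∧ `r = 1` at `p = 3` stays CONSTRUCTION-SHAPED (R6.2) /
O2 OPEN; nothing here books anything or changes a label. THEOREMS ONLY (no `def`, no named fact,
no `sorry`); every theorem is CONDITIONAL on the ONE OPEN binder (A|VoR)@3 (and, for the
two-routes statement, also on multr1-p2's open input `P2OpenInputOnTreeOddAt W 3` and the residual
typed inputs named below).

## What this file proves

The skeleton `Three/RouteR1Descent.lean` (p249126) had two named stubs; both are now tree theorems:
`stub_tamagawaDescentAt_three_holds` (`Three/RouteR1Tamagawa.lean`: link (C) at every odd `p` on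
erratum fields — Kodaira `I₀*`/`Iₙ*` for the ramified twist) and `stub_gzParaphraseAt_three_holds`
(`Three/RouteR1GrossZagier.lean`: link (B) at every odd `p` with `p ∤ w_K`, `w_K = 2` on erratum
fields). Hence:

* **`R1.bsdp_three_of_display`** — per pair, with a GIVEN erratum field: for `W/ℚ` globally
  minimal with `IsX11Three W` (`3 ∥ N_E`, `E[3]` irreducible, `ord_{s=1} L(E,s) = 1`) on the
  A′ ∧ (ram2)-locus at `3` (`X11.AprimeRam2LocusAt W 3`), an odd non-split multiplicative `q ≠ 3`
  with `3 ∤ v_q(Δ_min)` and an erratum field `K` for `q`: `BSD(E,3)` from SEVEN published named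
  facts (`hGZ` GZ86 I.7.3, `hGZK` GZK, `hSk` Skinner 2016 Thm. C [`p ≥ 3`, for `E^D`], `hmod`
  modularity, `hCST` CST14 Thm. 1.1, `hMaz` Mazur 1978 Cor. 4.1, `hNS` Néron scaling) and the ONE
  OPEN binder (A|VoR)@3 — NO stub left.
* **`R1.forall_bsdp_three_of_display`** — class level on the sub-population
  `IsX11Three ∧ X11.AprimeRam2LocusAt W 3 ∧ (∃ odd non-split ramified q)`, the field supplied by
  Friedberg–Hoffstein 1995 Thm. B (`hFH`). EIGHT published facts + (A|VoR)@3.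
* `R1.bsdp_three_of_display_of_witnesses` — data level (census columns only): `Mult W 3`, `Irr W 3`,
  `r = 1`, reduction at `3` non-split OR `3 ∤ v_3(Δ_min)` (then `E(ℚ₃)[3] = 0` is a THEOREM,
  `LocalTorsion.localTorsion_eq_zero_of_mult`, printed for `p ≥ 3`), an odd non-split multiplicative
  `q ≠ 3` with `3 ∤ v_q(Δ_min)`, a further multiplicative `ℓ ∉ {3, q}` with `3 ∤ v_ℓ(Δ_min)`.
* **`bsdp_of_classX11b_three_of_typedInputs_twoRoutes`** — X11b at `p = 3`, BOTH sub-cells' routes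
  in ONE statement: `∀ W, ClassX11b W 3 → BSDp W 3` from multr1-p2's twelve published facts + route
  R1's three further ones (`hGZ1`, `hCST`, `hFHr`) + `hNS`, multr1-p2's open input
  `P2OpenInputOnTreeOddAt W 3` [(IMC≥)∘(BDP) in INEQUALITY form at classical Heegner fields — no
  source at `3`], route R1's open input (A|VoR)@3 [display (5.3) in EQUALITY form at erratum fields —
  no source at `3`], the Euler-system half (T2′)@3 demanded ONLY OFF route R1's population at `3`
  (`hU'`), and the corner (T4″)@3. This is multr1-p1's `bsdp_of_classX11b_five_of_typedInputs_twoRoutes`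
  at `p = 3`: on R1's population ∩ (T2′)@3 the upper half comes with the display, so (T2′) — which
  has no source in print at ANY `p` — is not asked there.

## The open binder, once more (hypothesis police, `cells/x11b3/REFEREE.md` §2)

(A|VoR)@3 = `Display53At W 3 K P` at Manin-good Heegner data over erratum fields meeting
`Cas20Standing K 3 (N_E/3)`: NOT a cited fact; NO source and NO announcement at `p = 3`. Its `p ≥ 5`
derivation (erratum Thm. 1.1 ⇐ [FW21, Thm. 4.41]; [Cas20, Thm. 2.11] under §1's "`p ∤ 6N`"; the
reciprocity law [Cas20, Thm. 5.3]; Cas18 Thm. 3.2 ⇐ Castella JIMJ 17 "`p ≥ 5`", `E_{p−1}`) rests on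
rows H2, H3, H6 of the referee's table, all ⊥ at `(E, 3)`. What these files establish is only the
NEGATIVE-SPACE statement: given the display at `3`, NOTHING ELSE in Castella's §5 descent needs
`p ≥ 5` — the `p = 3` obstruction of route R1 is entirely Λ-adic (team items T1/T2/T6/T7).

References: [Castella2018] §5 (arXiv:1704.06608 p. 12); [Castella2018Erratum] Thm. 1.1, Thm. A′
(p. 1); [Castella2020JIMJ] §1, §2.5, Thm. 2.11; [JetchevSkinnerWan2017] §7.4.1–7.4.3;
[Skinner2016PacificMC] Thm. C and footnote 1; [CaiShuTian2014] Thm. 1.1; [GrossZagier1986] Thm. I.7.3;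
[Mazur1978] Cor. 4.1; [FriedbergHoffstein1995] Thm. B; [Miller2011LMS] Def. 1.1.
-/

noncomputable section

open scoped Classical

open WeierstrassCurve NumberField IsDedekindDomain Literature.NumberTheory.EllipticCurves
  Literature.NumberTheory.EllipticCurves.ModularForms
  Literature.NumberTheory.EllipticCurves.Rank1Residual
  Literature.NumberTheory.EllipticCurves.Rank1Residual.Typed
  Literature.NumberTheory.EllipticCurves.Wuthrich2014
  Literature.NumberTheory.GaloisCohomology Literature.NumberTheory.GaloisRepresentations

namespace Summit.BirchSwinnertonDyer.Rank1Residual.X11b.Three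

/-! ### Route R1's descent at `p = 3` with NO stub -/

section EndForm

/-- **Route R1's descent at `p = 3`, per pair with a GIVEN erratum field — the two stubs of the
skeleton DISCHARGED.** For `W/ℚ` globally minimal with `IsX11Three W` on the A′ ∧ (ram2)-locus at
`3`, an odd prime `q ≠ 3` of non-split multiplicative reduction with `3 ∤ v_q(Δ_min)`, and an
erratum field `K` for `q`: `BSD(E,3)` from the SEVEN published named facts `hGZ` (Gross–Zagier 1986
Thm. I.7.3), `hGZK` (Gross–Zagier–Kolyvagin), `hSk` (Skinner 2016 Thm. C, `p ≥ 3`, for `E^D`), `hmod`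
(modularity), `hCST` (Cai–Shu–Tian 2014 Thm. 1.1), `hMaz` (Mazur 1978 Cor. 4.1), `hNS` (Néron
scaling), and the ONE OPEN binder `hA` = (A|VoR)@3 (Castella's display (5.3) at `3` over erratum
fields meeting [Cas20, §2.5]; NOT a cited fact, no source nor announcement at `3` — module
docstring). `R1.bsdp_three_of_display_skeleton` with `stub_gzParaphraseAt_three_holds` (link (B)@3)
and `stub_tamagawaDescentAt_three_holds` (link (C)@3). CONDITIONAL on `hA`; deletes nothing; X11 ∧
`r = 1` at `3` stays CONSTRUCTION-SHAPED. [cite: Castella2018, §5 (arXiv:1704.06608 p. 12)]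
[cite: Castella2018Erratum, Thm. A′ (p. 1) with "p > 3" read as "p = 3" (shape only; nothing asserted)] -/
theorem R1.bsdp_three_of_display
    (hGZ : GrossZagier1986_thm_I_7_3) (hGZK : rank_eq_analyticRank_of_analyticRank_le_one)
    (hSk : Skinner2016.thmC_padicValRat_bsd_rank_zero) (hmod : exists_isNewformOf)
    (hCST : CaiShuTian2014.thm11_trivialChar)
    (hMaz : mazur_not_dvd_maninConstant_of_odd) (hNS : integral_neronScaling_of_isGloballyMinimal)
    -- OPEN: (A|VoR)@3 — the display (5.3) at `p = 3` over erratum fields meeting [Cas20, §2.5]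
    (hA : ∀ (W : WeierstrassCurve ℚ) [W.IsElliptic] [W.IsGloballyMinimal] [NeZero (W.conductorNorm ℤ)]
        (q : ℕ) [Fact q.Prime] (K : Type) [Field K] [NumberField K]
        (Dt : ModularParametrizationData W (W.conductorNorm ℤ))
        (H : HeegnerDatum (W.conductorNorm ℤ) (NumberField.discr K)) (ι : K →+* ℂ)
        (P : (W.baseChange K).toAffine.Point),
        IsX11Three W → X11.AprimeLocusAt W 3 → q ≠ 3 → Mult W q →
        ¬ W.HasSplitMultiplicativeReductionAtPrime q → ¬ 3 ∣ padicValInt q W.minimalDiscriminantInt →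
        IsErratumField W K q → Cas20Standing K 3 (W.conductorNorm ℤ / 3) →
        WeierstrassCurve.Affine.Point.map ι.toRatAlgHom P = heegnerPointComplex Dt H →
        ¬ (3 : ℤ) ∣ Dt.c → ¬ IsOfFinAddOrder P → Display53At W 3 K P)
    (W : WeierstrassCurve ℚ) [W.IsElliptic] [W.IsGloballyMinimal]
    (hX : IsX11Three W) (hloc : X11.AprimeRam2LocusAt W 3)
    (q : ℕ) [Fact q.Prime] (hq2 : q ≠ 2) (hq3 : q ≠ 3) (hmq : Mult W q)
    (hnsq : ¬ W.HasSplitMultiplicativeReductionAtPrime q)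
    (hvq : ¬ 3 ∣ padicValInt q W.minimalDiscriminantInt)
    (K : Type) [Field K] [NumberField K] (hKf : IsErratumField W K q) : BSDp W 3 :=
  R1.bsdp_three_of_display_skeleton hGZ hGZK hSk hmod hCST hMaz hNS hA
    (stub_gzParaphraseAt_three_holds hGZK (hasEntireLFunction_rat_of_exists_isNewformOf hmod) hCST)
    stub_tamagawaDescentAt_three_holds W hX hloc q hq2 hq3 hmq hnsq hvq K hKf

/-- **Route R1's descent at `p = 3`, class level on its sub-population, NO stub.** For EVERY globally
minimal elliptic `W/ℚ` with `IsX11Three W` on the A′ ∧ (ram2)-locus at `3` having an ODD non-split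
multiplicative `q ≠ 3` with `3 ∤ v_q(Δ_min)`: `BSD(E,3)`, from EIGHT published named facts (the
seven of `R1.bsdp_three_of_display` and `hFH`, Friedberg–Hoffstein 1995 Thm. B in the special case
"the erratum field exists", `erratumField_supply`) and the ONE OPEN binder (A|VoR)@3. The
sub-population is named exactly; NOT a statement about `IsX11Three` / X11b@3 as a whole.
CONDITIONAL on `hA`; deletes nothing; X11 ∧ `r = 1` at `3` stays CONSTRUCTION-SHAPED.
[cite: Castella2018, §5 (arXiv:1704.06608 p. 12)] [cite: FriedbergHoffstein1995, Thm. B (special case)]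
[cite: Castella2018Erratum, Thm. A′ (p. 1) with "p > 3" read as "p = 3" (shape only; nothing asserted)] -/
theorem R1.forall_bsdp_three_of_display
    (hGZ : GrossZagier1986_thm_I_7_3) (hGZK : rank_eq_analyticRank_of_analyticRank_le_one)
    (hSk : Skinner2016.thmC_padicValRat_bsd_rank_zero) (hmod : exists_isNewformOf)
    (hCST : CaiShuTian2014.thm11_trivialChar)
    (hFH : friedbergHoffstein_exists_twist_ne_zero_ramifiedAt)
    (hMaz : mazur_not_dvd_maninConstant_of_odd) (hNS : integral_neronScaling_of_isGloballyMinimal)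
    (hA : ∀ (W : WeierstrassCurve ℚ) [W.IsElliptic] [W.IsGloballyMinimal] [NeZero (W.conductorNorm ℤ)]
        (q : ℕ) [Fact q.Prime] (K : Type) [Field K] [NumberField K]
        (Dt : ModularParametrizationData W (W.conductorNorm ℤ))
        (H : HeegnerDatum (W.conductorNorm ℤ) (NumberField.discr K)) (ι : K →+* ℂ)
        (P : (W.baseChange K).toAffine.Point),
        IsX11Three W → X11.AprimeLocusAt W 3 → q ≠ 3 → Mult W q →
        ¬ W.HasSplitMultiplicativeReductionAtPrime q → ¬ 3 ∣ padicValInt q W.minimalDiscriminantInt →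
        IsErratumField W K q → Cas20Standing K 3 (W.conductorNorm ℤ / 3) →
        WeierstrassCurve.Affine.Point.map ι.toRatAlgHom P = heegnerPointComplex Dt H →
        ¬ (3 : ℤ) ∣ Dt.c → ¬ IsOfFinAddOrder P → Display53At W 3 K P) :
    ∀ (W : WeierstrassCurve ℚ) [W.IsElliptic] [W.IsGloballyMinimal],
      IsX11Three W → X11.AprimeRam2LocusAt W 3 →
      (∃ (q : ℕ) (_ : Fact q.Prime), q ≠ 2 ∧ q ≠ 3 ∧ Mult W q ∧
        ¬ W.HasSplitMultiplicativeReductionAtPrime q ∧ ¬ 3 ∣ padicValInt q W.minimalDiscriminantInt) →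
      BSDp W 3 := by
  intro W _ _ hX hloc ⟨q, hqF, hq2, hq3, hmq, hnsq, hvq⟩
  obtain ⟨K, _, _, hKf⟩ := erratumField_supply hmod hFH W 3 q hX.rank hmq hnsq
  exact R1.bsdp_three_of_display hGZ hGZK hSk hmod hCST hMaz hNS hA W hX hloc q hq2 hq3 hmq hnsq hvq
    K hKf

/-- **Route R1's descent at `p = 3`, DATA level (census columns only).** For `W/ℚ` globally minimal
elliptic with `ord_{s=1}L(E,s) = 1`, multiplicative at `3` with `E[3]` irreducible, whose reduction
at `3` is non-split or has `3 ∤ v_3(Δ_min)` (then `E(ℚ₃)[3] = 0` is a theorem printed for `p ≥ 3`: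
`LocalTorsion.localTorsion_eq_zero_of_mult`, Silverman *AEC* VII.6.1 / Tate curve), an ODD prime
`q ≠ 3` of non-split multiplicative reduction with `3 ∤ v_q(Δ_min)` and a further multiplicative
`ℓ ∉ {3, q}` with `3 ∤ v_ℓ(Δ_min)` (all decidable from Cremona-type data): `BSD(E,3)` from the eight
published facts and the OPEN binder (A|VoR)@3 (`R1.forall_bsdp_three_of_display`; the locus
`X11.AprimeRam2LocusAt W 3` assembled from the witnesses). CONDITIONAL on `hA`; deletes nothing.
[cite: Castella2018Erratum, Thm. A′ (p. 1) and Remark (p. 2) (shape only; nothing asserted)]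
[cite: SilvermanAEC2009, Thm VII.6.1 and Exercise 3.5] -/
theorem R1.bsdp_three_of_display_of_witnesses
    (hGZ : GrossZagier1986_thm_I_7_3) (hGZK : rank_eq_analyticRank_of_analyticRank_le_one)
    (hSk : Skinner2016.thmC_padicValRat_bsd_rank_zero) (hmod : exists_isNewformOf)
    (hCST : CaiShuTian2014.thm11_trivialChar)
    (hFH : friedbergHoffstein_exists_twist_ne_zero_ramifiedAt)
    (hMaz : mazur_not_dvd_maninConstant_of_odd) (hNS : integral_neronScaling_of_isGloballyMinimal)
    (hA : ∀ (W : WeierstrassCurve ℚ) [W.IsElliptic] [W.IsGloballyMinimal] [NeZero (W.conductorNorm ℤ)]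
        (q : ℕ) [Fact q.Prime] (K : Type) [Field K] [NumberField K]
        (Dt : ModularParametrizationData W (W.conductorNorm ℤ))
        (H : HeegnerDatum (W.conductorNorm ℤ) (NumberField.discr K)) (ι : K →+* ℂ)
        (P : (W.baseChange K).toAffine.Point),
        IsX11Three W → X11.AprimeLocusAt W 3 → q ≠ 3 → Mult W q →
        ¬ W.HasSplitMultiplicativeReductionAtPrime q → ¬ 3 ∣ padicValInt q W.minimalDiscriminantInt →
        IsErratumField W K q → Cas20Standing K 3 (W.conductorNorm ℤ / 3) →
        WeierstrassCurve.Affine.Point.map ι.toRatAlgHom P = heegnerPointComplex Dt H →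
        ¬ (3 : ℤ) ∣ Dt.c → ¬ IsOfFinAddOrder P → Display53At W 3 K P)
    (W : WeierstrassCurve ℚ) [W.IsElliptic] [W.IsGloballyMinimal]
    (hmult : Mult W 3) (hirr : Irr W 3) (hr : W.analyticRank = 1)
    (hloc : ¬ W.HasSplitMultiplicativeReductionAtPrime 3 ∨ ¬ 3 ∣ padicValInt 3 W.minimalDiscriminantInt)
    {q : ℕ} [Fact q.Prime] {ℓ : ℕ} [Fact ℓ.Prime] (hq2 : q ≠ 2) (hq3 : q ≠ 3) (hℓ3 : ℓ ≠ 3)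
    (hℓq : ℓ ≠ q) (hmq : Mult W q) (hnsq : ¬ W.HasSplitMultiplicativeReductionAtPrime q)
    (hvq : ¬ 3 ∣ padicValInt q W.minimalDiscriminantInt)
    (hmℓ : Mult W ℓ) (hvℓ : ¬ 3 ∣ padicValInt ℓ W.minimalDiscriminantInt) : BSDp W 3 :=
  R1.forall_bsdp_three_of_display hGZ hGZK hSk hmod hCST hFH hMaz hNS hA W ⟨hmult, hirr, hr⟩
    ⟨⟨q, ‹_›, ℓ, ‹_›, hq3, hℓ3, hℓq, hmq, hnsq, hvq, hmℓ, hvℓ⟩,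
      fun P hP ↦ LocalTorsion.localTorsion_eq_zero_of_mult W 3 le_rfl hmult hloc P hP⟩
    ⟨q, ‹_›, hq2, hq3, hmq, hnsq, hvq⟩

end EndForm

/-! ### X11b at `p = 3`: both sub-cells' routes in ONE statement -/

section TwoRoutes

/-- **X11b at `p = 3`, BOTH routes: multr1-p2's `P2.bsdp_three_of_onTree` with its Euler-system
input (T2′)@3 required ONLY OFF route R1's population at `3`.** For every globally minimal elliptic
`W/ℚ` with `(E,3) ∈` X11b (`ClassX11b W 3`: `r_an = 1`, `3 ∥ N`, `E[3]` irreducible): `BSD(E,3)`,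
from the PUBLISHED named facts of both routes (multr1-p2's twelve: Gross–Zagier, Kolyvagin ×2,
Skinner 2016 Thm. C, Wuthrich 2014 Prop. 21, GZK, modularity ×2, Hoffstein–Luo, Mazur 1978 Cor. 4.1,
Poitou–Tate, local Euler characteristic; route R1's further `hGZ1` Gross–Zagier 1986 I.7.3, `hCST`
Cai–Shu–Tian 2014 Thm. 1.1, `hFHr` Friedberg–Hoffstein 1995 Thm. B, `hNS` Néron scaling), and the
typed inputs: `hA2` = multr1-p2's open input `P2OpenInputOnTreeOddAt W 3` [(IMC≥)∘(BDP) in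
INEQUALITY form at classical Heegner fields; NO source, not even announced, at `3`]; `hA1` = route
R1's open input (A|VoR)@3 [Castella's display (5.3) in EQUALITY form at erratum fields; NO source at
`3`]; (T2′∖R1)@3 `hU'` = the Euler-system half `Typed.MissingUpperBoundAt W 3` at surjective pairs
OFF the unconditional atom `(ram) ∧ 3 ∤ ∏c` AND OFF route R1's population at `3` (the A′ ∧ (ram2)
locus with an odd non-split ramified `q`) — on that population the upper half comes with the
display (`R1.forall_bsdp_three_of_display ⟹ BSDp ⟹ MissingPPartAt ⟹` upper half); (T4″)@3 `hC` =
the non-surjective corner. multr1-p1's `bsdp_of_classX11b_five_of_typedInputs_twoRoutes` at `p = 3`.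
CONDITIONAL; deletes nothing; X11 ∧ `r = 1` at `3` stays CONSTRUCTION-SHAPED; no label change.
[cite: JetchevSkinnerWan2017, §7.4.1–7.4.3 (pp. 30–31)] [cite: Castella2018, §5 (arXiv:1704.06608 p. 12)]
[cite: Castella2018Erratum, Thm. 1.1, Thm. A′ (p. 1) with "p > 3" read as "p = 3" (shape only; nothing asserted)]
[cite: Miller2011LMS, Def. 1.1] -/
theorem bsdp_of_classX11b_three_of_typedInputs_twoRoutes
    -- published inputs of multr1-p2's `P2.bsdp_three_of_onTree`
    (hGZ : ∀ (N : ℕ) [NeZero N] (W : WeierstrassCurve ℚ) (K : Type) [Field K] [NumberField K],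
      gross_zagier N W K)
    (hKo : ∀ (N : ℕ) [NeZero N] (W : WeierstrassCurve ℚ) (K : Type) [Field K] [NumberField K],
      kolyvagin N W K)
    (hB : ∀ (N : ℕ) [NeZero N] (W : WeierstrassCurve ℚ) (K : Type) [Field K] [NumberField K],
      Kolyvagin1990_padicValNat_card_sha_le N W K)
    (hSk : Skinner2016.thmC_padicValRat_bsd_rank_zero) (hWu : sha_dvd_analyticSha)
    (hGZK : rank_eq_analyticRank_of_analyticRank_le_one) (hmod : hasEntireLFunction_rat)
    (hnf : exists_isNewformOf) (hHL : HoffsteinLuo1997_exists_twist_L_one_ne_zero)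
    (hMaz : mazur_not_dvd_maninConstant_of_odd)
    (hPT : ∀ (K : Type) [Field K] [NumberField K], poitouTate_sum_localTatePairing_eq_zero K)
    (hEP : ∀ (K : Type) [Field K] [NumberField K] (v : HeightOneSpectrum (𝓞 K)),
      localEulerPoincareCharacteristic (v.adicCompletion K))
    -- the further published inputs of route R1
    (hGZ1 : GrossZagier1986_thm_I_7_3) (hCST : CaiShuTian2014.thm11_trivialChar)
    (hFHr : friedbergHoffstein_exists_twist_ne_zero_ramifiedAt)
    (hNS : integral_neronScaling_of_isGloballyMinimal)
    -- multr1-p2's open input at `3` ((IMC≥)∘(BDP), inequality form, classical Heegner fields)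
    (hA2 : ∀ (W : WeierstrassCurve ℚ) [W.IsElliptic] [W.IsGloballyMinimal], P2OpenInputOnTreeOddAt W 3)
    -- route R1's open input at `3` ((A|VoR)@3, equality form, erratum fields)
    (hA1 : ∀ (W : WeierstrassCurve ℚ) [W.IsElliptic] [W.IsGloballyMinimal] [NeZero (W.conductorNorm ℤ)]
        (q : ℕ) [Fact q.Prime] (K : Type) [Field K] [NumberField K]
        (Dt : ModularParametrizationData W (W.conductorNorm ℤ))
        (H : HeegnerDatum (W.conductorNorm ℤ) (NumberField.discr K)) (ι : K →+* ℂ)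
        (P : (W.baseChange K).toAffine.Point),
        IsX11Three W → X11.AprimeLocusAt W 3 → q ≠ 3 → Mult W q →
        ¬ W.HasSplitMultiplicativeReductionAtPrime q → ¬ 3 ∣ padicValInt q W.minimalDiscriminantInt →
        IsErratumField W K q → Cas20Standing K 3 (W.conductorNorm ℤ / 3) →
        WeierstrassCurve.Affine.Point.map ι.toRatAlgHom P = heegnerPointComplex Dt H →
        ¬ (3 : ℤ) ∣ Dt.c → ¬ IsOfFinAddOrder P → Display53At W 3 K P)
    -- (T2′∖R1)@3: the Euler-system half, OFF the unconditional atom and OFF route R1's population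
    (hU' : ∀ (W : WeierstrassCurve ℚ) [W.IsElliptic] [W.IsGloballyMinimal],
      ClassX11b W 3 → Surj W 3 → ¬ (Ram W 3 ∧ ¬ 3 ∣ W.tamagawaProduct) →
      ¬ (X11.AprimeRam2LocusAt W 3 ∧
          ∃ (q : ℕ) (_ : Fact q.Prime), q ≠ 2 ∧ q ≠ 3 ∧ Mult W q ∧
            ¬ W.HasSplitMultiplicativeReductionAtPrime q ∧
            ¬ 3 ∣ padicValInt q W.minimalDiscriminantInt) →
      Typed.MissingUpperBoundAt W 3)
    -- (T4″)@3: the non-surjective corner, localised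
    (hC : ∀ (W : WeierstrassCurve ℚ) [W.IsElliptic] [W.IsGloballyMinimal],
      ClassX11b W 3 → ¬ Surj W 3 → 3 ∣ padicValInt 3 W.minimalDiscriminantInt → ¬ Ram W 3 →
        Typed.MissingPPartAt W 3)
    (W : WeierstrassCurve ℚ) [W.IsElliptic] [W.IsGloballyMinimal] (hX : ClassX11b W 3) :
    BSDp W 3 := by
  refine P2.bsdp_three_of_onTree hGZ hKo hB hSk hWu hGZK hmod hnf hHL hMaz hPT hEP hA2 ?_ hC W hX
  intro W _ _ hX hs hnot
  by_cases hR : X11.AprimeRam2LocusAt W 3 ∧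
      ∃ (q : ℕ) (_ : Fact q.Prime), q ≠ 2 ∧ q ≠ 3 ∧ Mult W q ∧
        ¬ W.HasSplitMultiplicativeReductionAtPrime q ∧ ¬ 3 ∣ padicValInt q W.minimalDiscriminantInt
  · obtain ⟨hloc, hq⟩ := hR
    have hX3 : IsX11Three W := ⟨hX.2.2.1, hX.2.2.2, hX.1⟩
    have hb : BSDp W 3 :=
      R1.forall_bsdp_three_of_display hGZ1 hGZK hSk hnf hCST hFHr hMaz hNS hA1 W hX3 hloc hq
    haveI : Finite W.sha := (hGZK W (le_of_eq hX.1)).2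
    exact (Typed.lower_and_upper_of_missingPPartAt W 3 (Typed.missingPPartAt_of_bsdp W 3 hb)).2
  · exact hU' W hX hs hnot hR

end TwoRoutes

/-! ### Data level on the atom `3 ∤ ∏ c`: no condition at `3` -/

section NotDvd

/-- **Route R1's descent at `p = 3`, DATA level on `3 ∤ ∏_ℓ c_ℓ(E)` — no hypothesis on the
reduction at `3`.** For `W/ℚ` globally minimal elliptic with `ord_{s=1}L(E,s) = 1`, multiplicative
at `3` with `E[3]` irreducible and `3 ∤ ∏_ℓ c_ℓ(E)` (then `E(ℚ₃)[3] = 0` is a THEOREM printed for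
`p ≥ 3`: `c₃ ∣ ∏ c`, and a split `3` with `E(ℚ₃)[3] ≠ 0` would force `3 ∣ v_3(Δ_min) = c₃` —
`LocalTorsion.localTorsion_eq_zero_of_not_dvd_tamagawaProduct`, Silverman *ATAEC* IV.9.2), an ODD
prime `q ≠ 3` of non-split multiplicative reduction with `3 ∤ v_q(Δ_min)` and a further multiplicative
`ℓ ∉ {3, q}` with `3 ∤ v_ℓ(Δ_min)`: `BSD(E,3)` from the eight published facts and the OPEN binder
(A|VoR)@3. This is the census atom A1 ∩ (R1's witnesses) (seat census `census-r1three`: 147 046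
class-pairs with `N < 5·10⁵`); multr1-p1's `chainLocus_of_witnesses_of_not_dvd_tamagawaProduct` at
`p = 3`. CONDITIONAL on `hA`; deletes nothing; no label change.
[cite: SilvermanATAEC1994, Cor. IV.9.2(d) with (b) (PDF p. 340)]
[cite: Castella2018Erratum, Thm. A′ (p. 1) and Remark (p. 2) (shape only; nothing asserted)] -/
theorem R1.bsdp_three_of_display_of_witnesses_of_not_dvd_tamagawaProduct
    (hGZ : GrossZagier1986_thm_I_7_3) (hGZK : rank_eq_analyticRank_of_analyticRank_le_one)
    (hSk : Skinner2016.thmC_padicValRat_bsd_rank_zero) (hmod : exists_isNewformOf)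
    (hCST : CaiShuTian2014.thm11_trivialChar)
    (hFH : friedbergHoffstein_exists_twist_ne_zero_ramifiedAt)
    (hMaz : mazur_not_dvd_maninConstant_of_odd) (hNS : integral_neronScaling_of_isGloballyMinimal)
    (hA : ∀ (W : WeierstrassCurve ℚ) [W.IsElliptic] [W.IsGloballyMinimal] [NeZero (W.conductorNorm ℤ)]
        (q : ℕ) [Fact q.Prime] (K : Type) [Field K] [NumberField K]
        (Dt : ModularParametrizationData W (W.conductorNorm ℤ))
        (H : HeegnerDatum (W.conductorNorm ℤ) (NumberField.discr K)) (ι : K →+* ℂ)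
        (P : (W.baseChange K).toAffine.Point),
        IsX11Three W → X11.AprimeLocusAt W 3 → q ≠ 3 → Mult W q →
        ¬ W.HasSplitMultiplicativeReductionAtPrime q → ¬ 3 ∣ padicValInt q W.minimalDiscriminantInt →
        IsErratumField W K q → Cas20Standing K 3 (W.conductorNorm ℤ / 3) →
        WeierstrassCurve.Affine.Point.map ι.toRatAlgHom P = heegnerPointComplex Dt H →
        ¬ (3 : ℤ) ∣ Dt.c → ¬ IsOfFinAddOrder P → Display53At W 3 K P)
    (W : WeierstrassCurve ℚ) [W.IsElliptic] [W.IsGloballyMinimal]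
    (hmult : Mult W 3) (hirr : Irr W 3) (hr : W.analyticRank = 1)
    (htam : ¬ 3 ∣ W.tamagawaProduct)
    {q : ℕ} [Fact q.Prime] {ℓ : ℕ} [Fact ℓ.Prime] (hq2 : q ≠ 2) (hq3 : q ≠ 3) (hℓ3 : ℓ ≠ 3)
    (hℓq : ℓ ≠ q) (hmq : Mult W q) (hnsq : ¬ W.HasSplitMultiplicativeReductionAtPrime q)
    (hvq : ¬ 3 ∣ padicValInt q W.minimalDiscriminantInt)
    (hmℓ : Mult W ℓ) (hvℓ : ¬ 3 ∣ padicValInt ℓ W.minimalDiscriminantInt) : BSDp W 3 :=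
  R1.forall_bsdp_three_of_display hGZ hGZK hSk hmod hCST hFH hMaz hNS hA W ⟨hmult, hirr, hr⟩
    ⟨⟨q, ‹_›, ℓ, ‹_›, hq3, hℓ3, hℓq, hmq, hnsq, hvq, hmℓ, hvℓ⟩,
      LocalTorsion.localTorsion_eq_zero_of_not_dvd_tamagawaProduct W 3 le_rfl hmult htam⟩
    ⟨q, ‹_›, hq2, hq3, hmq, hnsq, hvq⟩

end NotDvd

end Summit.BirchSwinnertonDyer.Rank1Residual.X11b.Three

end
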